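import Summits.BirchSwinnertonDyer.Rank1Residual.O5.HeegnerLogTransportThreeTwoSidedRow240930b1
import Summits.BirchSwinnertonDyer.Rank1Residual.O5.HeegnerLogTransportThreeTwoSidedRow149895d1
import Summits.BirchSwinnertonDyer.Rank1Residual.O5.HeegnerLogTransportThreeTwoSidedRow430425o1
import Summits.BirchSwinnertonDyer.Rank1Residual.Supersingular.SurjFrobeniusOrderCertificateShape
import HarnessLib
import HarnessLib.Audit.Tags

/-!
# (t′) at `p = 3` — the `hρ` binder (`ρ̄_{W,3}` onto) of the three TWO-SIDED row ENDs RETIRED IN THE KERNEL: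
# two Frobenius witnesses per row (o5-r2 GEN 27, part 26)

HONEST FRAMING. Research route; **O5 ((t′): additive potentially-supersingular reduction at an
anomalous prime) stays OPEN**; conditional on the displayed hypotheses; nothing booked; no
RESIDUAL-MAP mark, label, count or tier moves. This file contains NO new mathematics about (t′) and NO
new tool: it applies the supersingular family's certificate shape
`Supersingular.surj_three_of_ainvs_of_irr_of_order` (x11c's
`GaloisImage.hasSurjectiveModNGaloisRep_of_intModel_of_irr_of_order` packaged for a literal equation:
`ρ̄_{E,3}` is onto `GL₂(𝔽₃)` as soon as two good odd primes `ℓ₁, ℓ₂ ≠ 3` are exhibited with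
(i) `X² − a_{ℓ₁}X + ℓ₁` IRREDUCIBLE mod `3` — the image lies in no Borel subgroup — and
(ii) `ℓ₂ ≡ 1`, `a_{ℓ₂} ≡ 2 (mod 3)`, `9 ∤ #Ẽ(𝔽_{ℓ₂})` — the Frobenius at `ℓ₂` is a non-identity
transvection on `E[3]`, an element of ORDER `3` —, then Serre's Prop. 15 with `det = χ̄₃` onto) to the
three additive curves `W` of the two-sided row ENDs of parts 25c / 25d / 25e, whose END theorems
`o5_index_unit_row240930b1`, `o5_index_unit_row149895d1`, `o5_index_unit_row430425o1` displayed
`hρ : W.HasSurjectiveModNGaloisRep 3` as an instrument-read DATA binder (Cremona `galrep`). The traces come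
from kernel point counts (`countPoints`, `decide +kernel`; no `native_decide`); global minimality is the
rows' own kernel theorem (`isGloballyMinimal_W…`, Kraus support certificate).

Witnesses (each re-verified by the kernel below):
* `W = 240930b1 = [1, −1, 0, −5896734, 5517669140]`: (i) `ℓ₁ = 23`, `#W̃(𝔽₂₃) = 26`, `a = −2`,
  `X² + 2X + 23 ≡ X² − X − 1` has no root mod `3`; (ii) `ℓ₂ = 7 ≡ 1`, `#W̃(𝔽₇) = 12`, `a = −4 ≡ 2 (mod 3)`,
  `9 ∤ 12`.
* `W = 149895d1 = [1, −1, 1, −353, 2782]`: (i) `ℓ₁ = 17`, `#W̃(𝔽₁₇) = 25`, `a = −7`, `X² + 7X + 17 ≡ X² + X − 1`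
  has no root mod `3`; (ii) `ℓ₂ = 109 ≡ 1`, `#W̃(𝔽₁₀₉) = 123`, `a = −13 ≡ 2 (mod 3)`, `9 ∤ 123`.
* `W = 430425o1 = [0, 0, 1, 675, 36281]`: (i) `ℓ₁ = 11`, `#W̃(𝔽₁₁) = 16`, `a = −4`, `X² + 4X + 11 ≡ X² + X − 1`
  has no root mod `3`; (ii) `ℓ₂ = 19 ≡ 1`, `#W̃(𝔽₁₉) = 24`, `a = −4 ≡ 2 (mod 3)`, `9 ∤ 24`.

Main statements: `surjThree_W240930b1`, `surjThree_W149895d1`, `surjThree_W430425o1` (unconditional kernel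
theorems), and the three row ENDs WITHOUT `hρ`: `o5_index_unit_row240930b1_of_frobenius`,
`o5_index_unit_row149895d1_of_frobenius`, `o5_index_unit_row430425o1_of_frobenius`.

What these ENDs STILL DISPLAY (honest list, one item shorter than parts 25c–25e): the published theorems
BY NAME (`hKL` Kriz–Li 1.16, `hYZ` Yan–Zhu 4.15 PUB*, `hW20` Wuthrich Lemma 20, `hmod`, `hGZK`, `hKoG`,
`hGZG`); the Heegner / modular-parametrisation data over an imaginary quadratic field `K` of the row's
discriminant and the non-torsion of the two Heegner points; the two sharp `3`-descents `hSelG`, `hSelGd`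
(instrument: Cremona/LMFDB `Ш[3] = 0` on `G`, `G^(d)`); the Manin binders `hcD`, `hc3′` (optimal
parametrisations, `c = 1`, EVIDENCE). Census support is EVIDENCE, never a Literature fact.

References: [cite: Serre1972, §2.4 Prop. 15 and §5.2 (iii)] [cite: SilvermanAEC2009, III.6.4 (b), VII.1 Remark 1.1 and VII.3.1 (b)]
[cite: IrelandRosen1990, Prop. 5.1.2] [cite: CremonaAlgorithms1997, §3.2 and Table 1]
[cite: KrizLi2019, Theorem 1.16 (arXiv:1609.06687v4 pp. 7-8)] [cite: GrossZagier1986, Thm. I.6.3] [cite: Kolyvagin1990, Thm. A]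

Typed by `planner-b2b-bsdres-o5-r2-g27-0` (o5-r2 GEN 27, part 26). Target path
`O5/HeegnerLogTransportThreeTwoSidedRowsSurjThree.lean` (NEW leaf; imports the three row END halves of parts
25c / 25d / 25e and the built `Supersingular/SurjFrobeniusOrderCertificateShape.lean`). Nothing booked.

### cc-typer-5 GEN 20 (O5 §3.5 / O6 §3.4 typer of record) — by-name ask A-O5-G27-1 (amended, P.S. 3) of o5-r2 GEN 27, HOME/INBOX.md l.15049: 'place PART 26 b1db13c0ab5562ef LAST,
by sha (kind as the gate infers: theorems only)'; memo `HOME/b2b-bsdres-o5-r2/gen27/O5-GEN27.md`.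

Source: `HOME/b2b-bsdres-o5-r2/gen27/lean/HeegnerLogTransportThreeTwoSidedRowsSurjThree.lean` sha16 `b1db13c0ab5562ef` (207 l.; `gen27/SHA16.txt`; o5-r2's farm checks rc 0 / 0
warnings / 0 sorries, axioms standard, dedup clean),
re-hashed by the typer right before writing; THIS file = the source VERBATIM + this paragraph (imports, module text, every declaration block byte-identical; script
`class-closure/typer-5/gen20/g28_place.py`, docstring anchor asserted); imports the three row-END modules `…TwoSidedRow240930b1` / `…Row149895d1` / `…Row430425o1` (this seat's
ROW files of the 25c / 25d / 25e splits — the typer's own MODELS/ROW split kept the asked module names exactly so these three imports resolve byte-identically) + the built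
`Supersingular.SurjFrobeniusOrderCertificateShape` — all in the tree; the typer's own standalone farm check
on tree imports (rc 0 / 0 warnings / 0 sorries; `#print axioms` of the ENDs standard) and DEDUP (`lean search --decl` on the new names: no match) precede the proposal.
CONTENT LABELS (source, unchanged): THEOREMS ONLY (6: `surjThree_W240930b1` / `_W149895d1` / `_W430425o1` — `ρ̄_{W,3}` onto, UNCONDITIONAL kernel theorems by x11c's
two-Frobenius-witness criterion `Supersingular.surj_three_of_ainvs_of_irr_of_order` + `decide +kernel` point counts — and the `hρ`-FREE row ENDs
`o5_index_unit_row240930b1_of_frobenius` / `…row149895d1_of_frobenius` / `…row430425o1_of_frobenius`); 0 `def`, 0 `@[conjecture]`, 0 Literature facts (net named-fact debt 0), no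
`sorry`; published inputs stay displayed hypotheses
BY NAME, nothing re-proved.  HONEST FRAMING (cell `b2b-bsdres`): research route, lane CLASS-CLOSURE §3.5 O5; CONDITIONAL ENDs — nothing asserted beyond the displayed binders,
nothing booked, no mark / label / count / tier of `RESIDUAL-MAP.md` moves; census / instrument statements (`hIdx`, `hQunit`, `hShaAnGd`, the 3-descents) = EVIDENCE or
displayed binders, never a Literature fact; O5 OPEN.
-/

set_option autoImplicit false

open scoped Classical

open WeierstrassCurve Literature.NumberTheory.EllipticCurves
  Literature.NumberTheory.EllipticCurves.ModularForms
  Literature.NumberTheory.EllipticCurves.Rank1Residual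
  Literature.NumberTheory.EllipticCurves.Rank1Residual.Typed
open Literature.NumberTheory.EllipticCurves.Rank1Residual.X11RankOneCertificates (countPoints discOf)
open Summit.BirchSwinnertonDyer.Rank1Residual.Supersingular (surj_three_of_ainvs_of_irr_of_order)
open IsDedekindDomain (HeightOneSpectrum)
open scoped NumberField

namespace Summit.BirchSwinnertonDyer.Rank1Residual.O5.HeegnerLogTransport

open KL3TwoSidedRows

/-! ### §1 `ρ̄_{W,3}` onto for the three row curves — kernel certificates -/

/-- **`ρ̄_{W,3}` is surjective for `W = 240930b1`** (`[1, −1, 0, −5896734, 5517669140]`, `N = 240930`):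
Frobenius witnesses (i) `ℓ₁ = 23`: `#W̃(𝔽₂₃) = 26`, `a = −2`, `X² − aX + 23` irreducible mod `3`;
(ii) `ℓ₂ = 7 ≡ 1 (mod 3)`: `#W̃(𝔽₇) = 12`, `a = −4 ≡ 2`, `9 ∤ 12` (a Frobenius of order `3`) — all
kernel-decided (`decide +kernel`, no `native_decide`); global minimality = part 25c's `isGloballyMinimal_W240930b1`.
Retires the `hρ` binder of `o5_index_unit_row240930b1`. [cite: Serre1972, §2.4 Prop. 15 and §5.2 (iii)]
[cite: SilvermanAEC2009, VII.3.1(b) and III.6.4(b)] [cite: CremonaAlgorithms1997, Table 1 (Cremona label 240930b1)] -/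
theorem surjThree_W240930b1 : W240930b1.HasSurjectiveModNGaloisRep 3 :=
  surj_three_of_ainvs_of_irr_of_order 1 (-1) 0 (-5896734) 5517669140 isGloballyMinimal_W240930b1
    23 7 (by norm_num) (by norm_num) (by decide) (by decide) (by decide) (by decide)
    (by decide +kernel) (by decide +kernel)
    (n₁ := 26) (n₂ := 12) (by decide +kernel) (by decide +kernel)
    (by decide) (by decide) (by decide) (by decide)

/-- **`ρ̄_{W,3}` is surjective for `W = 149895d1`** (`[1, −1, 1, −353, 2782]`, `N = 149895`): Frobenius
witnesses (i) `ℓ₁ = 17`: `#W̃(𝔽₁₇) = 25`, `a = −7`, `X² − aX + 17` irreducible mod `3`; (ii) `ℓ₂ = 109 ≡ 1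
(mod 3)`: `#W̃(𝔽₁₀₉) = 123`, `a = −13 ≡ 2`, `9 ∤ 123` (a Frobenius of order `3`) — all kernel-decided;
global minimality = part 25d's `isGloballyMinimal_W149895d1`. Retires the `hρ` binder of
`o5_index_unit_row149895d1`. [cite: Serre1972, §2.4 Prop. 15 and §5.2 (iii)]
[cite: SilvermanAEC2009, VII.3.1(b) and III.6.4(b)] [cite: CremonaAlgorithms1997, Table 1 (Cremona label 149895d1)] -/
theorem surjThree_W149895d1 : W149895d1.HasSurjectiveModNGaloisRep 3 :=
  surj_three_of_ainvs_of_irr_of_order 1 (-1) 1 (-353) 2782 isGloballyMinimal_W149895d1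
    17 109 (by norm_num) (by norm_num) (by decide) (by decide) (by decide) (by decide)
    (by decide +kernel) (by decide +kernel)
    (n₁ := 25) (n₂ := 123) (by decide +kernel) (by decide +kernel)
    (by decide) (by decide) (by decide) (by decide)

/-- **`ρ̄_{W,3}` is surjective for `W = 430425o1`** (`[0, 0, 1, 675, 36281]`, `N = 430425`): Frobenius
witnesses (i) `ℓ₁ = 11`: `#W̃(𝔽₁₁) = 16`, `a = −4`, `X² − aX + 11` irreducible mod `3`; (ii) `ℓ₂ = 19 ≡ 1
(mod 3)`: `#W̃(𝔽₁₉) = 24`, `a = −4 ≡ 2`, `9 ∤ 24` (a Frobenius of order `3`) — all kernel-decided; global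
minimality = part 25e's `isGloballyMinimal_W430425o1`. Retires the `hρ` binder of `o5_index_unit_row430425o1`.
[cite: Serre1972, §2.4 Prop. 15 and §5.2 (iii)] [cite: SilvermanAEC2009, VII.3.1(b) and III.6.4(b)]
[cite: CremonaAlgorithms1997, Table 1 (Cremona label 430425o1)] -/
theorem surjThree_W430425o1 : W430425o1.HasSurjectiveModNGaloisRep 3 :=
  surj_three_of_ainvs_of_irr_of_order 0 0 1 675 36281 isGloballyMinimal_W430425o1
    11 19 (by norm_num) (by norm_num) (by decide) (by decide) (by decide) (by decide)
    (by decide +kernel) (by decide +kernel)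
    (n₁ := 16) (n₂ := 24) (by decide +kernel) (by decide +kernel)
    (by decide) (by decide) (by decide) (by decide)

/-! ### §2 The three two-sided row ENDs with `hρ` discharged -/

/-- **TWO-SIDED END on the row `240930b1 ~ 26770a1` (`d_K = −551`) WITHOUT the `hρ` binder**:
`o5_index_unit_row240930b1` (part 25c) with `ρ̄_{W,3}` onto supplied by the kernel certificate
`surjThree_W240930b1`. Every finitary binder of the two-sided END (part 25b) about the three curves
`W, G, G^(−551)` AND the mod-`3` image of `W` is now decided in the kernel; what remains displayed is the
honest list of the module docstring (published theorems by name, Heegner / modular-parametrisation data,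
the two sharp `3`-descents, the Manin binders). Conditional theorem; research route; O5 OPEN; nothing
booked. [cite: KrizLi2019, Theorem 1.16 (arXiv:1609.06687v4 pp. 7-8)] [cite: Serre1972, §2.4 Prop. 15 and §5.2 (iii)]
[cite: GrossZagier1986, Thm. I.6.3] [cite: Kolyvagin1990, Thm. A] [cite: YanZhu2026, Theorem 4.15] -/
theorem o5_index_unit_row240930b1_of_frobenius
    (hKL : KrizLi2019.thm116_padicLogHeegner_congruence)
    (hYZ : YanZhu2026.thm415_padicValRat_bsd_rank_le_one)
    (hW20 : Wuthrich2014.lemma20_surjective_threeAdic_of_semistable)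
    (hmod : exists_isNewformOf) (hGZK : rank_eq_analyticRank_of_analyticRank_le_one)
    {N N' : ℕ} [NeZero N] [NeZero N'] (D : ModularParametrizationData W240930b1 N)
    (D' : ModularParametrizationData G26770a1 N')
    (K : Type) [Field K] [NumberField K] (hK : IsImaginaryQuadratic K) (hdK : NumberField.discr K = -551)
    (hH : SatisfiesHeegnerHypothesis N K) (hH' : SatisfiesHeegnerHypothesis N' K)
    (h3K : SatisfiesHeegnerHypothesis 3 K)
    (hKoG : kolyvagin N' G26770a1 K) (hGZG : gross_zagier N' G26770a1 K)
    (H : HeegnerDatum N (NumberField.discr K)) (H' : HeegnerDatum N' (NumberField.discr K))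
    (ι : K →+* ℂ) (ι₃ : K →+* ℚ_[3])
    (P : (W240930b1.baseChange K).toAffine.Point) (P' : (G26770a1.baseChange K).toAffine.Point)
    (hP : WeierstrassCurve.Affine.Point.map ι.toRatAlgHom P = heegnerPointComplex D H)
    (hP' : WeierstrassCurve.Affine.Point.map ι.toRatAlgHom P' = heegnerPointComplex D' H')
    (hPinf : ¬ IsOfFinAddOrder P) (hP'inf : ¬ IsOfFinAddOrder P')
    (hSelG : Nat.card (G26770a1.selmerGroup (3 : ℤ)) = 3 ^ G26770a1.mordellWeilRank)
    (hSelGd : Nat.card (Gd551.selmerGroup (3 : ℤ)) = 3 ^ Gd551.mordellWeilRank)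
    (hcD : padicValInt 3 D.maninConstant = 0) (hc3' : ¬ ((3 : ℤ) ∣ D'.maninConstant)) :
    padicValNat 3 (AddSubgroup.zmultiples P).index = 0 :=
  o5_index_unit_row240930b1 hKL hYZ hW20 hmod hGZK surjThree_W240930b1 D D' K hK hdK hH hH' h3K hKoG hGZG
    H H' ι ι₃ P P' hP hP' hPinf hP'inf hSelG hSelGd hcD hc3'

/-- **TWO-SIDED END on the row `149895d1 ~ 16655c1` (`d_K = −356`) WITHOUT the `hρ` binder**:
`o5_index_unit_row149895d1` (part 25d) with `ρ̄_{W,3}` onto supplied by `surjThree_W149895d1`.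
Conditional theorem; research route; O5 OPEN; nothing booked.
[cite: KrizLi2019, Theorem 1.16 (arXiv:1609.06687v4 pp. 7-8)] [cite: Serre1972, §2.4 Prop. 15 and §5.2 (iii)]
[cite: GrossZagier1986, Thm. I.6.3] [cite: Kolyvagin1990, Thm. A] [cite: YanZhu2026, Theorem 4.15] -/
theorem o5_index_unit_row149895d1_of_frobenius
    (hKL : KrizLi2019.thm116_padicLogHeegner_congruence)
    (hYZ : YanZhu2026.thm415_padicValRat_bsd_rank_le_one)
    (hW20 : Wuthrich2014.lemma20_surjective_threeAdic_of_semistable)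
    (hmod : exists_isNewformOf) (hGZK : rank_eq_analyticRank_of_analyticRank_le_one)
    {N N' : ℕ} [NeZero N] [NeZero N'] (D : ModularParametrizationData W149895d1 N)
    (D' : ModularParametrizationData G16655c1 N')
    (K : Type) [Field K] [NumberField K] (hK : IsImaginaryQuadratic K) (hdK : NumberField.discr K = -356)
    (hH : SatisfiesHeegnerHypothesis N K) (hH' : SatisfiesHeegnerHypothesis N' K)
    (h3K : SatisfiesHeegnerHypothesis 3 K)
    (hKoG : kolyvagin N' G16655c1 K) (hGZG : gross_zagier N' G16655c1 K)
    (H : HeegnerDatum N (NumberField.discr K)) (H' : HeegnerDatum N' (NumberField.discr K))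
    (ι : K →+* ℂ) (ι₃ : K →+* ℚ_[3])
    (P : (W149895d1.baseChange K).toAffine.Point) (P' : (G16655c1.baseChange K).toAffine.Point)
    (hP : WeierstrassCurve.Affine.Point.map ι.toRatAlgHom P = heegnerPointComplex D H)
    (hP' : WeierstrassCurve.Affine.Point.map ι.toRatAlgHom P' = heegnerPointComplex D' H')
    (hPinf : ¬ IsOfFinAddOrder P) (hP'inf : ¬ IsOfFinAddOrder P')
    (hSelG : Nat.card (G16655c1.selmerGroup (3 : ℤ)) = 3 ^ G16655c1.mordellWeilRank)
    (hSelGd : Nat.card (Gd356.selmerGroup (3 : ℤ)) = 3 ^ Gd356.mordellWeilRank)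
    (hcD : padicValInt 3 D.maninConstant = 0) (hc3' : ¬ ((3 : ℤ) ∣ D'.maninConstant)) :
    padicValNat 3 (AddSubgroup.zmultiples P).index = 0 :=
  o5_index_unit_row149895d1 hKL hYZ hW20 hmod hGZK surjThree_W149895d1 D D' K hK hdK hH hH' h3K hKoG hGZG
    H H' ι ι₃ P P' hP hP' hPinf hP'inf hSelG hSelGd hcD hc3'

/-- **TWO-SIDED END on the row `430425o1 ~ 47825d1` (`d_K = −344`) WITHOUT the `hρ` binder**:
`o5_index_unit_row430425o1` (part 25e) with `ρ̄_{W,3}` onto supplied by `surjThree_W430425o1`.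
Conditional theorem; research route; O5 OPEN; nothing booked.
[cite: KrizLi2019, Theorem 1.16 (arXiv:1609.06687v4 pp. 7-8)] [cite: Serre1972, §2.4 Prop. 15 and §5.2 (iii)]
[cite: GrossZagier1986, Thm. I.6.3] [cite: Kolyvagin1990, Thm. A] [cite: YanZhu2026, Theorem 4.15] -/
theorem o5_index_unit_row430425o1_of_frobenius
    (hKL : KrizLi2019.thm116_padicLogHeegner_congruence)
    (hYZ : YanZhu2026.thm415_padicValRat_bsd_rank_le_one)
    (hW20 : Wuthrich2014.lemma20_surjective_threeAdic_of_semistable)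
    (hmod : exists_isNewformOf) (hGZK : rank_eq_analyticRank_of_analyticRank_le_one)
    {N N' : ℕ} [NeZero N] [NeZero N'] (D : ModularParametrizationData W430425o1 N)
    (D' : ModularParametrizationData G47825d1 N')
    (K : Type) [Field K] [NumberField K] (hK : IsImaginaryQuadratic K) (hdK : NumberField.discr K = -344)
    (hH : SatisfiesHeegnerHypothesis N K) (hH' : SatisfiesHeegnerHypothesis N' K)
    (h3K : SatisfiesHeegnerHypothesis 3 K)
    (hKoG : kolyvagin N' G47825d1 K) (hGZG : gross_zagier N' G47825d1 K)
    (H : HeegnerDatum N (NumberField.discr K)) (H' : HeegnerDatum N' (NumberField.discr K))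
    (ι : K →+* ℂ) (ι₃ : K →+* ℚ_[3])
    (P : (W430425o1.baseChange K).toAffine.Point) (P' : (G47825d1.baseChange K).toAffine.Point)
    (hP : WeierstrassCurve.Affine.Point.map ι.toRatAlgHom P = heegnerPointComplex D H)
    (hP' : WeierstrassCurve.Affine.Point.map ι.toRatAlgHom P' = heegnerPointComplex D' H')
    (hPinf : ¬ IsOfFinAddOrder P) (hP'inf : ¬ IsOfFinAddOrder P')
    (hSelG : Nat.card (G47825d1.selmerGroup (3 : ℤ)) = 3 ^ G47825d1.mordellWeilRank)
    (hSelGd : Nat.card (Gd344.selmerGroup (3 : ℤ)) = 3 ^ Gd344.mordellWeilRank)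
    (hcD : padicValInt 3 D.maninConstant = 0) (hc3' : ¬ ((3 : ℤ) ∣ D'.maninConstant)) :
    padicValNat 3 (AddSubgroup.zmultiples P).index = 0 :=
  o5_index_unit_row430425o1 hKL hYZ hW20 hmod hGZK surjThree_W430425o1 D D' K hK hdK hH hH' h3K hKoG hGZG
    H H' ι ι₃ P P' hP hP' hPinf hP'inf hSelG hSelGd hcD hc3'

end Summit.BirchSwinnertonDyer.Rank1Residual.O5.HeegnerLogTransport
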